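import Summits.AtomisticToContinuum.Crystallization.Theorems.PalmUnimodularRigidityLayeredLawsSelectHcpLocalCongruence

/-!
# Exact stars at an h-type site give an exact frame, I: the contacts of an h-type site of a general Barlow
# stacking (stub `stub_exactFrameH`, X2a of line `palm-good-law`, crux `ReggeStarCoercivity.DefectFreeCrystallizes`,
# stmt-AtomisticToContinuum-13603; part 1 of 2)

The combinatorics behind the port of 9226's `exists_frame` (alternating word) to a GENERAL Hägg word `s` at an
h-type site `u` (`s (u.1 − 1) ≠ s u.1`).  The twelve contacts of `u` are labelled by `hcpStarIdx` through the
map `N ε = (u.1 + ε.1, u.2.1 + s u.1 · ε.2.1, u.2.2 + s u.1 · ε.2.2)` (`u + ε` if `s u.1 = 1`, `u + (ε₁, −ε₂, −ε₃)`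
if `s u.1 = −1`; we carry `N` as a function with its defining equation `hN`, no new definition):

* `dist_eq_one_iff_nbr`: the sites of the ideal stacking `barlowStacking 1 √(2/3) s` at distance `1` from the
  site `u` are exactly the `N ε`, `ε ∈ hcpStarIdx` (`BarlowCoordination.dist_barlowPos_eq_iff` and four
  `decide`s on the offset tables);
* `exists_twist`: there is ONE linear isometry `T` (the identity if `s u.1 = 1`, the half-turn otherwise) with
  `barlowPos a h s (N ε) − barlowPos a h s u = T (hcpSite a h ε)` for EVERY spacing `(a, h)` and every label:
  the relaxed star of an h-type site of any stacking is the twisted relaxed hcp star;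
* `star_dist_gt_six_fifths`: non-touching relaxed struts are `> 6/5` apart on the box (the `6/5`-window variant
  of 9226's `star_dist_gt`);
* `exactCopy_of_iInf_eq_zero`: a vanishing congruence defect of a finite family against a finite non-empty set
  is attained by an exact labelled copy (the generic form of 9226's `stub_localCongruenceExactStar`).

All `[folklore]`.
-/

noncomputable section

open scoped BigOperators

namespace Summit.AtomisticToContinuum.Crystallization.Theorems.PalmGoodLaw.ExactFrameH

open Literature.MathematicalPhysics.StatisticalMechanics Literature.Geometry.DiscreteGeometry
open Summit.AtomisticToContinuum.Crystallization.Theorems.PalmUnimodularRigidity.LayeredLawsSelectHcp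

/-! ## The contacts of an h-type site of a general Barlow stacking -/

/-- The in-layer contact offsets are star labels of layer `0` (both signs; by `decide`). [folklore] -/
theorem offsets_six : ∀ PQ ∈ sixOffsets,
    ((0 : ℤ), -PQ.1, -PQ.2) ∈ hcpStarIdx ∧ ((0 : ℤ), PQ.1, PQ.2) ∈ hcpStarIdx := by
  decide

/-- The adjacent-layer contact offsets for letter shift `−1` are, negated, the star labels of layers `±1`
(by `decide`). [folklore] -/
theorem offsets_three_neg : ∀ PQ ∈ threeOffsets (-1),
    ((1 : ℤ), -PQ.1, -PQ.2) ∈ hcpStarIdx ∧ ((-1 : ℤ), -PQ.1, -PQ.2) ∈ hcpStarIdx := by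
  decide

/-- The adjacent-layer contact offsets for letter shift `1` are the star labels of layers `±1` (by `decide`).
[folklore] -/
theorem offsets_three_pos : ∀ PQ ∈ threeOffsets 1,
    ((1 : ℤ), PQ.1, PQ.2) ∈ hcpStarIdx ∧ ((-1 : ℤ), PQ.1, PQ.2) ∈ hcpStarIdx := by
  decide

/-- Every star label is a contact offset (by `decide`). [folklore] -/
theorem star_offsets : ∀ ε ∈ hcpStarIdx,
    (ε.1 = 0 ∧ (-ε.2.1, -ε.2.2) ∈ sixOffsets ∧ (ε.2.1, ε.2.2) ∈ sixOffsets) ∨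
    ((ε.1 = 1 ∨ ε.1 = -1) ∧ (-ε.2.1, -ε.2.2) ∈ threeOffsets (-1) ∧ (ε.2.1, ε.2.2) ∈ threeOffsets 1) := by
  decide

/-- Star labels live on the layers `0, ±1` (by `decide`). [folklore] -/
theorem star_fst_cases : ∀ ε ∈ hcpStarIdx, ε.1 = 0 ∨ ε.1 = 1 ∨ ε.1 = -1 := by
  decide

/-- At an h-type site the letter steps below and above are opposite. [folklore] -/
theorem pred_eq_neg {s : ℤ → ℤ} (hs : IsHaggSeq s) {k : ℤ} (hu : s (k - 1) ≠ s k) : s (k - 1) = -s k := by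
  rcases hs k with h | h <;> rcases hs (k - 1) with h' | h' <;> omega

/-- Anchor of this part file (registered sub-goal `exactFrameH_part01_anchor` of stmt-AtomisticToContinuum-13603):
at an h-type site of a Hägg word the letter steps below and above are opposite. [folklore] -/
theorem exactFrameH_part01_anchor : ∀ s : ℤ → ℤ, IsHaggSeq s → ∀ k : ℤ, s (k - 1) ≠ s k → s (k - 1) = -s k :=
  fun _ hs _ hu => pred_eq_neg hs hu

section HSite

variable {s : ℤ → ℤ} {u : ℤ × ℤ × ℤ} {N : ℤ × ℤ × ℤ → ℤ × ℤ × ℤ}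

/-- The labelled neighbour map `N ε = (u.1 + ε.1, u.2.1 + s u.1 · ε.2.1, u.2.2 + s u.1 · ε.2.2)` of a site of a
Hägg word is injective. [folklore] -/
theorem nbr_injective (hs : IsHaggSeq s)
    (hN : ∀ ε, N ε = (u.1 + ε.1, u.2.1 + s u.1 * ε.2.1, u.2.2 + s u.1 * ε.2.2)) : Function.Injective N := by
  rintro ⟨e₁, e₂, e₃⟩ ⟨f₁, f₂, f₃⟩ h
  rw [hN, hN] at h
  simp only [Prod.mk.injEq] at h ⊢
  rcases hs u.1 with hσ | hσ <;> rw [hσ] at h <;> omega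

/-- **The contacts of an h-type site.** For a Hägg word `s` and a site `u` with `s (u.1 − 1) ≠ s u.1`, the sites
of the ideal stacking `barlowStacking 1 √(2/3) s` at distance `1` from the site `u` are exactly the labelled
neighbours `N ε`, `ε ∈ hcpStarIdx`. [folklore] -/
theorem dist_eq_one_iff_nbr (hs : IsHaggSeq s) (hu : s (u.1 - 1) ≠ s u.1)
    (hN : ∀ ε, N ε = (u.1 + ε.1, u.2.1 + s u.1 * ε.2.1, u.2.2 + s u.1 * ε.2.2)) (w : ℤ × ℤ × ℤ) :
    dist (barlowPos 1 (Real.sqrt (2 / 3)) s u.1 u.2.1 u.2.2)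
        (barlowPos 1 (Real.sqrt (2 / 3)) s w.1 w.2.1 w.2.2) = 1 ↔ ∃ ε ∈ hcpStarIdx, w = N ε := by
  simp only [hN]
  obtain ⟨k, i, j⟩ := u
  obtain ⟨k', i', j'⟩ := w
  dsimp only at hu ⊢
  have hpred : s (k - 1) = -s k := pred_eq_neg hs hu
  rw [dist_barlowPos_eq_iff hs one_pos sqrt_twoThirds_sq, hpred]
  rcases hs k with hσ | hσ <;> rw [hσ] <;> simp only [neg_neg, one_mul, neg_one_mul, Prod.mk.injEq]
  · constructor
    · rintro (⟨rfl, hm⟩ | ⟨rfl, hm⟩ | ⟨rfl, hm⟩)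
      · refine ⟨(0, -(i - i'), -(j - j')), (offsets_six _ hm).1, ?_, ?_, ?_⟩ <;> dsimp only <;> omega
      · refine ⟨(1, -(i - i'), -(j - j')), (offsets_three_neg _ hm).1, ?_, ?_, ?_⟩ <;> dsimp only <;> omega
      · refine ⟨(-1, -(i - i'), -(j - j')), (offsets_three_neg _ hm).2, ?_, ?_, ?_⟩ <;> dsimp only <;> omega
    · rintro ⟨ε, hε, rfl, rfl, rfl⟩
      have e : (i - (i + ε.2.1), j - (j + ε.2.2)) = (-ε.2.1, -ε.2.2) := by
        simp only [Prod.mk.injEq]; constructor <;> ring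
      rw [e]
      rcases star_offsets ε hε with ⟨h1, h6, -⟩ | ⟨h1 | h1, h3, -⟩
      · exact Or.inl ⟨by omega, h6⟩
      · exact Or.inr (Or.inl ⟨by omega, h3⟩)
      · exact Or.inr (Or.inr ⟨by omega, h3⟩)
  · constructor
    · rintro (⟨rfl, hm⟩ | ⟨rfl, hm⟩ | ⟨rfl, hm⟩)
      · refine ⟨(0, i - i', j - j'), (offsets_six _ hm).2, ?_, ?_, ?_⟩ <;> dsimp only <;> omega
      · refine ⟨(1, i - i', j - j'), (offsets_three_pos _ hm).1, ?_, ?_, ?_⟩ <;> dsimp only <;> omega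
      · refine ⟨(-1, i - i', j - j'), (offsets_three_pos _ hm).2, ?_, ?_, ?_⟩ <;> dsimp only <;> omega
    · rintro ⟨ε, hε, rfl, rfl, rfl⟩
      have e : (i - (i + -ε.2.1), j - (j + -ε.2.2)) = (ε.2.1, ε.2.2) := by
        simp only [Prod.mk.injEq]; constructor <;> ring
      rw [e]
      rcases star_offsets ε hε with ⟨h1, -, h6⟩ | ⟨h1 | h1, -, h3⟩
      · exact Or.inl ⟨by omega, h6⟩
      · exact Or.inr (Or.inl ⟨by omega, h3⟩)
      · exact Or.inr (Or.inr ⟨by omega, h3⟩)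

/-- **The relaxed star of an h-type site is a twisted relaxed hcp star, for EVERY spacing `(a, h)`**: one linear
isometry `T` (the identity if `s u.1 = 1`, the half-turn about the vertical axis otherwise) has
`barlowPos a h s (N ε) − barlowPos a h s u = T (hcpSite a h ε)` for all `(a, h)` and all `ε ∈ hcpStarIdx` (the
letters of the layers `u.1 ± 1` are both `L + s u.1`, as the letters `1, 1` of the layers `±1` of hcp around the
letter `0` of layer `0`). [folklore] -/
theorem exists_twist (hs : IsHaggSeq s) (hu : s (u.1 - 1) ≠ s u.1)
    (hN : ∀ ε, N ε = (u.1 + ε.1, u.2.1 + s u.1 * ε.2.1, u.2.2 + s u.1 * ε.2.2)) :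
    ∃ T : EuclideanSpace ℝ (Fin 3) ≃ₗᵢ[ℝ] EuclideanSpace ℝ (Fin 3), ∀ a h : ℝ, ∀ ε ∈ hcpStarIdx,
      barlowPos a h s (N ε).1 (N ε).2.1 (N ε).2.2 - barlowPos a h s u.1 u.2.1 u.2.2 = T (hcpSite a h ε) := by
  simp only [hN]
  obtain ⟨k, i, j⟩ := u
  dsimp only at hu ⊢
  have hpred : s (k - 1) = -s k := pred_eq_neg hs hu
  have hL1 : haggLabel s (k + 1) = haggLabel s k + s k := haggLabel_succ s k
  have hL2 : haggLabel s (k + -1) = haggLabel s k + s k := by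
    have h1 := haggLabel_succ s (k - 1)
    rw [sub_add_cancel, hpred] at h1
    rw [← sub_eq_add_neg]
    linarith
  have hA0 : haggLabel alternatingHagg 0 = 0 := haggLabel_zero _
  have hA1 : haggLabel alternatingHagg 1 = 1 := by rw [haggLabel_alternating_eq_emod]; rfl
  have hA2 : haggLabel alternatingHagg (-1) = 1 := by rw [haggLabel_alternating_eq_emod]; rfl
  rcases hs k with hσ | hσ
  · refine ⟨LinearIsometryEquiv.refl ℝ _, fun a h ε hε => ?_⟩
    have hk := star_fst_cases ε hε
    obtain ⟨e₁, e₂, e₃⟩ := ε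
    dsimp only at hk ⊢
    rcases hk with rfl | rfl | rfl <;> simp only [LinearIsometryEquiv.coe_refl, id_eq] <;>
      ext l <;> fin_cases l <;> simp [hcpSite, hL1, hL2, hA0, hA1, hA2, hσ] <;> ring
  · refine ⟨halfTurn, fun a h ε hε => ?_⟩
    have hk := star_fst_cases ε hε
    obtain ⟨e₁, e₂, e₃⟩ := ε
    dsimp only at hk ⊢
    rcases hk with rfl | rfl | rfl <;> simp only [halfTurn_apply] <;>
      ext l <;> fin_cases l <;> simp [hcpSite, halfTurnFun, hL1, hL2, hA0, hA1, hA2, hσ] <;> ring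

end HSite

/-- **Non-touching struts of the relaxed star are `> 6/5` apart** (the variant of 9226's `star_dist_gt` for the
chart window `6/5`; only `a ≥ 189/200`, `h ≥ 77/100` are used). [folklore] -/
theorem star_dist_gt_six_fifths {a h : ℝ} (ha₁ : 189 / 200 ≤ a) (hh₁ : 77 / 100 ≤ h) {v w : ℤ × ℤ × ℤ}
    (hv : v ∈ hcpStarIdx) (hw : w ∈ hcpStarIdx) (hne : v ≠ w)
    (hvw : dist (hcpSite 1 (Real.sqrt (2 / 3)) v) (hcpSite 1 (Real.sqrt (2 / 3)) w) ≠ 1) :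
    6 / 5 < dist (hcpSite a h v) (hcpSite a h w) := by
  obtain ⟨m, rfl⟩ := exists_starLab_eq hv
  obtain ⟨n, rfl⟩ := exists_starLab_eq hw
  have hmn : m ≠ n := fun h => hne (by rw [h])
  rw [Ne, dist_ideal_eq_one_iff] at hvw
  have hsq := hcpSite_dist_sq a h (starLab m) (starLab n)
  obtain ⟨hq1, hq2⟩ := siteQ_nonneg (starLab m) (starLab n)
  have hq1' : (0 : ℝ) ≤ (siteQ (starLab m) (starLab n)).1 := by exact_mod_cast hq1
  have hq2' : (0 : ℝ) ≤ (siteQ (starLab m) (starLab n)).2 := by exact_mod_cast hq2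
  rcases star_pairs.1 m n hmn with ⟨hq, -⟩ | ⟨-, hfar⟩
  · exact absurd hq hvw
  · have hlow : (6 / 5 : ℝ) ^ 2 < dist (hcpSite a h (starLab m)) (hcpSite a h (starLab n)) ^ 2 := by
      rcases hfar with h4 | ⟨h1, h16⟩ | h24
      · have h4' : (4 : ℝ) ≤ (siteQ (starLab m) (starLab n)).2 := by exact_mod_cast h4
        rw [hsq]; nlinarith
      · have h1' : (1 : ℝ) ≤ (siteQ (starLab m) (starLab n)).2 := by exact_mod_cast h1
        have h16' : (16 : ℝ) ≤ (siteQ (starLab m) (starLab n)).1 := by exact_mod_cast h16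
        rw [hsq]; nlinarith
      · have h24' : (24 : ℝ) ≤ (siteQ (starLab m) (starLab n)).1 := by exact_mod_cast h24
        rw [hsq]; nlinarith
    exact lt_of_pow_lt_pow_left₀ 2 dist_nonneg hlow

/-! ## A vanishing congruence defect against a finite set is attained -/

/-- **A vanishing congruence defect of a finite family against a finite non-empty set is attained by an exact
labelled copy** (the generic form of 9226's `stub_localCongruenceExactStar`): if
`inf_A ∑_{v ∈ I} dist(A (y v), Z)² = 0` then some `g : I → Z` has exactly the mutual distances and lengths of
the `y v` (finitely many labellings, each with positive total mismatch unless exact; an `A` with defect `< ε²`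
yields a labelling with mismatch `≤ (2n² + n) ε`, `n = #I`). [folklore] -/
theorem exactCopy_of_iInf_eq_zero {ι : Type*} (I : Finset ι) (y : ι → EuclideanSpace ℝ (Fin 3))
    (Z : Finset (EuclideanSpace ℝ (Fin 3))) (hZ : Z.Nonempty)
    (h0 : (⨅ A : EuclideanSpace ℝ (Fin 3) ≃ₗᵢ[ℝ] EuclideanSpace ℝ (Fin 3),
      ∑ v ∈ I, Metric.infDist (A (y v)) ↑Z ^ 2) = 0) :
    ∃ g : ι → EuclideanSpace ℝ (Fin 3), (∀ v ∈ I, g v ∈ Z) ∧ (∀ v ∈ I, ‖g v‖ = ‖y v‖) ∧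
      ∀ v ∈ I, ∀ w ∈ I, dist (g v) (g w) = dist (y v) (y w) := by
  classical
  by_contra H
  set M : (↥I → EuclideanSpace ℝ (Fin 3)) → ℝ := fun g =>
    (∑ v, ∑ w, |dist (g v) (g w) - dist (y v) (y w)|) + ∑ v, |‖g v‖ - ‖y v‖| with hM
  set G : Finset (↥I → EuclideanSpace ℝ (Fin 3)) := Fintype.piFinset fun _ => Z with hG
  have hGne : G.Nonempty := by
    obtain ⟨z, hz⟩ := hZ
    exact ⟨fun _ => z, Fintype.mem_piFinset.2 fun _ => hz⟩
  have hMpos : ∀ g ∈ G, 0 < M g := by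
    intro g hg
    rw [hG, Fintype.mem_piFinset] at hg
    by_contra hle
    have hM0 : M g = 0 := le_antisymm (not_lt.1 hle) (by positivity)
    have hs1 : ∀ v, ∑ w, |dist (g v) (g w) - dist (y v) (y w)| = 0 ∧ |‖g v‖ - ‖y v‖| = 0 := by
      have hA : (∑ v, ∑ w, |dist (g v) (g w) - dist (y v) (y w)|) = 0 ∧ (∑ v, |‖g v‖ - ‖y v‖|) = 0 :=
        (add_eq_zero_iff_of_nonneg (by positivity) (by positivity)).1 hM0
      intro v
      exact ⟨(Finset.sum_eq_zero_iff_of_nonneg fun _ _ => by positivity).1 hA.1 v (Finset.mem_univ v),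
        (Finset.sum_eq_zero_iff_of_nonneg fun _ _ => by positivity).1 hA.2 v (Finset.mem_univ v)⟩
    have hs2 : ∀ v w, |dist (g v) (g w) - dist (y v) (y w)| = 0 := fun v w =>
      (Finset.sum_eq_zero_iff_of_nonneg fun _ _ => by positivity).1 (hs1 v).1 w (Finset.mem_univ w)
    refine H ⟨fun v => if hv : v ∈ I then g ⟨v, hv⟩ else 0, fun v hv => ?_, fun v hv => ?_,
      fun v hv w hw => ?_⟩
    · dsimp only; rw [dif_pos hv]; exact hg ⟨v, hv⟩
    · dsimp only; rw [dif_pos hv]; exact eq_of_abs_sub_eq_zero (hs1 ⟨v, hv⟩).2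
    · dsimp only; rw [dif_pos hv, dif_pos hw]; exact eq_of_abs_sub_eq_zero (hs2 ⟨v, hv⟩ ⟨w, hw⟩)
  have hμ : 0 < G.inf' hGne M := (Finset.lt_inf'_iff hGne).2 hMpos
  set n : ℕ := I.card with hn
  set ε : ℝ := G.inf' hGne M / (2 * (n : ℝ) ^ 2 + n + 1) with hε
  have hden : (0 : ℝ) < 2 * (n : ℝ) ^ 2 + n + 1 := by positivity
  have hε0 : 0 < ε := by positivity
  haveI : Nonempty (EuclideanSpace ℝ (Fin 3) ≃ₗᵢ[ℝ] EuclideanSpace ℝ (Fin 3)) :=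
    ⟨LinearIsometryEquiv.refl ℝ _⟩
  have hlt : (⨅ A : EuclideanSpace ℝ (Fin 3) ≃ₗᵢ[ℝ] EuclideanSpace ℝ (Fin 3),
      ∑ v ∈ I, Metric.infDist (A (y v)) ↑Z ^ 2) < ε ^ 2 := by
    rw [h0]; positivity
  obtain ⟨A, hA⟩ := exists_lt_of_ciInf_lt hlt
  -- every reference point has a point of `Z` within `ε`
  have hnear : ∀ v ∈ I, ∃ z ∈ Z, dist (A (y v)) z < ε := by
    intro v hv
    have hle : Metric.infDist (A (y v)) ↑Z ^ 2 ≤ ∑ w ∈ I, Metric.infDist (A (y w)) ↑Z ^ 2 :=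
      Finset.single_le_sum (f := fun w => Metric.infDist (A (y w)) ↑Z ^ 2) (fun w _ => sq_nonneg _) hv
    have hlt' : Metric.infDist (A (y v)) ↑Z < ε := lt_of_pow_lt_pow_left₀ 2 hε0.le (hle.trans_lt hA)
    obtain ⟨z, hz, hd⟩ := (Metric.infDist_lt_iff (Finset.coe_nonempty.2 hZ)).1 hlt'
    exact ⟨z, hz, hd⟩
  choose! gz hgZ hgd using hnear
  set g : ↥I → EuclideanSpace ℝ (Fin 3) := fun v => gz v with hgdef
  have hgG : g ∈ G := by rw [hG, Fintype.mem_piFinset]; exact fun v => hgZ v v.2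
  have hle : G.inf' hGne M ≤ M g := Finset.inf'_le M hgG
  -- but the mismatch of `g` is `≤ (2n² + n) ε`
  have ht1 : ∀ v w : ↥I, |dist (g v) (g w) - dist (y v) (y w)| ≤ 2 * ε := by
    intro v w
    have hv := hgd v v.2
    have hw := hgd w w.2
    rw [← A.dist_map (y v) (y w)]
    calc |dist (g v) (g w) - dist (A (y v)) (A (y w))|
        ≤ |dist (g v) (g w) - dist (A (y v)) (g w)| + |dist (A (y v)) (g w) - dist (A (y v)) (A (y w))| :=
          abs_sub_le _ _ _
      _ ≤ dist (g v) (A (y v)) + dist (g w) (A (y w)) := by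
          gcongr
          · exact abs_dist_sub_le _ _ _
          · rw [dist_comm (A (y v)) (g w), dist_comm (A (y v)) (A (y w))]; exact abs_dist_sub_le _ _ _
      _ ≤ 2 * ε := by rw [dist_comm] at hv hw; simp only [hgdef]; linarith
  have ht2 : ∀ v : ↥I, |‖g v‖ - ‖y v‖| ≤ ε := by
    intro v
    have hv := hgd v v.2
    rw [← A.norm_map (y v)]
    calc |‖g v‖ - ‖A (y v)‖| ≤ ‖g v - A (y v)‖ := abs_norm_sub_norm_le _ _
      _ ≤ ε := by rw [← dist_eq_norm, dist_comm]; exact hv.le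
  have hcard : (Finset.univ : Finset ↥I).card = n := by simp [hn]
  have hMg : M g ≤ n * (n * (2 * ε)) + n * ε := by
    apply add_le_add
    · calc (∑ v, ∑ w, |dist (g v) (g w) - dist (y v) (y w)|) ≤ ∑ _v : ↥I, ∑ _w : ↥I, 2 * ε :=
            Finset.sum_le_sum fun v _ => Finset.sum_le_sum fun w _ => ht1 v w
        _ = n * (n * (2 * ε)) := by simp only [Finset.sum_const, hcard, nsmul_eq_mul]
    · calc (∑ v, |‖g v‖ - ‖y v‖|) ≤ ∑ _v : ↥I, ε := Finset.sum_le_sum fun v _ => ht2 v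
        _ = n * ε := by simp only [Finset.sum_const, hcard, nsmul_eq_mul]
  have hinf : G.inf' hGne M = (2 * (n : ℝ) ^ 2 + n + 1) * ε := by
    rw [hε]; field_simp
  have : (n : ℝ) * (n * (2 * ε)) + n * ε < G.inf' hGne M := by rw [hinf]; nlinarith
  linarith

end Summit.AtomisticToContinuum.Crystallization.Theorems.PalmGoodLaw.ExactFrameH

end
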